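import Summits.QuantumFields.BalabanUV.T4Continuum.Support.NE7SliceLimitWorkingRegion
import HarnessLib

/-!
# NE7SliceFrameMatchingLimit — FRAME MATCHING AT THE LIMIT OF THE (S1) ORBIT: along a sitewise-uniformly convergent orbit `u_j → u⋆` of the slice iteration whose defect tends to zero,
# the accumulated frame of the limit's tangent part EQUALS the limit's corner logs — `framePotW L (k+1) W (T(u⋆)) z = h(u⋆) z` for every coarse site `z`, i.e. `m(u⋆) = 0`
# (named ask [NE7P1-G102-ASK-1] of the row-NE7 owner, `HOME/INBOX.md` L.2551; it identifies `h⋆ = F(T⋆)`, the input of (S2)'s corner-charge bookkeeping, memo ROAD-G102 §4.4)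

Cell `pub-balaban`, rung (B)+1 sub-cell t4, lineage `b2b-balaban-t4-ne7b-p1`, generation 151 (OWNER of BINDER row NE7b; junction service for the NE crew, ruling R-OWNER-149-1 (2)).
A JUNCTION for row NE7 (node U5), asked by name.  The state maps are t4-ne7-p1's `NE7SliceIterationState` (`repLog` = `X(u)`, `cornerLog` = `h(u)`, `tangentPart` = `T(u)`, `frameMismatch`
= `m(u) = sup_z ‖framePotW T(u) z − h(u) z‖`, `sliceDefect` = `Df(u) = δ(u) + m(u)∕M`), with the working-region facts `NE7SliceIterationStateFacts.norm_frame_le_frameMismatch` (`≤ m(u)`),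
`frameMismatch_le_sliceDefect` (`m(u) ≤ M·Df(u)`); the continuity inputs are the additivity of the accumulated frames `NE3CurvedFrameKill.framePotW_add`, the sup letter
`NE3LinearisedAverageSup.norm_framePotW_le_sup` (`‖framePotW Y z‖ ≤ 6d·M·sup‖Y‖`, no skewness ∕ periodicity needed), the sup-Lipschitz letter of the tangent part
`NE7SliceTangentPartLimit.norm_tangentPart_sub_le` (`lipT`) and of the corner logs `norm_cornerLog_sub_le` (`4∕3`), and gen 150's `NE7SliceLimitWorkingRegion.workingRegion_of_limit`.
THE ARGUMENT (three terms, then `j → ∞`): `‖F(T(u⋆)) z − h(u⋆) z‖ ≤ ‖F(T(u⋆) − T(u_j)) z‖ + ‖F(T(u_j)) z − h(u_j) z‖ + ‖h(u_j) z − h(u⋆) z‖ ≤ 6dM·lipT·r_j + M·Df(u_j) + (4∕3)·r_j → 0`.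
WHAT ([folklore]; 0 def, 0 sorry; multi-level small-field class at `W`, `L ≥ 2`, `M = L^{k+1}`).
§1 `framePotW_sub` (the accumulated frame of a difference), `norm_framePotW_sub_le` (`‖F(A) z − F(B) z‖ ≤ 6dM·s` for `sup‖A − B‖ ≤ s`).
§2 two states `u`, `v` of the working region with `sup‖u − v‖ ≤ ρ`: **`norm_framePotW_tangentPart_sub_le`** (`‖F(T(u)) z − F(T(v)) z‖ ≤ 6dM·lipT·ρ`),
   **`norm_frame_le_of_near`** (`‖F(T(v)) z − h(v) z‖ ≤ M·Df(u) + (6dM·lipT + 4∕3)·ρ` — the frame mismatch of `v` is controlled by the DEFECT OF ITS NEIGHBOUR `u`).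
§3 the limit, in the rate shape of `NE7SliceTangentPartLimit.tangentPart_limit_mem` (working region for every `u j` and for `u⋆`, uniform rate `r j → 0`, `Df(u j) → 0`):
   **`framePotW_limit_eq_cornerLog`** (`∀ z, F(T(u⋆)) z = h(u⋆) z`), **`frameMismatch_limit_eq_zero_of_rate`** (`m(u⋆) = 0`).
§4 the limit, in the one-call shape of `NE7SliceLimitWorkingRegion.tangentPart_limit_mem_of_geometric` (exactly the binders `slice_orbit` ∕ `slice_theorem` hold: per-`j` facts, `u⋆` unitary
   `(tower)`-periodic, sitewise `Tendsto`, geometric rate `C·ϑ^j`, `Df(u j) ≤ ϑ^j·δ₀`): **`frameMismatch_limit_eq_zero`** (`∀ z, F(T(u⋆)) z = h(u⋆) z` — the asked signature) and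
   **`frameMismatch_limit_val_eq_zero`** (`frameMismatch … u⋆ = 0`).
§5 (v2 APPEND) THE LIMIT IS AN EXACT FIXED POINT (same one-call shape): **`split_limit_trivial`** (`Ỹ(u⋆) = T(u⋆)`, `gaugeDir W ζ(u⋆) = 0` — `NE7SliceSplitUnique.slice_split_of_mem`),
   `slicePart_limit_eq_tangentPart`, **`sliceDefect_limit_eq_zero`** (`Df(u⋆) = 0`), and for Poincaré parameter `θ_P ≤ 1∕2`: **`gaugeFun_limit_eq_zero`** (`ζ(u⋆) = 0`,
   `NE7SliceIterationStateFacts.norm_gaugeFun_le`), **`sliceStep_limit_eq_self`** (`sliceStep u⋆ = u⋆`).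
HONEST FRAMING (page 1): continuity bookkeeping over the road's state maps and row NE3's letters BY NAME; nothing of Bałaban's asserted; NOT (S2) (the direct letters), NOT the structural
letter `Q₂ − R₂∘F`, NOT F4e, NOT NE7, nothing of row NE7b; spine 0∕9; finite T⁴ rung (B)+1 — NOT infinite volume, NOT mass gap, NOT BetaPertH, NOT Clay.  Continuum YM on T⁴ ⇐ BetaPertH ∧
nine spine estimates (0/9 proved); BetaPertH ⇐ (D1) ∧ (D4) ∧ CAP+tail; G-an2-4 gates asym, D1 and NE2/3/4.
-/

set_option autoImplicit false

open scoped BigOperators Matrix.Norms.L2Operator Topology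
open NormedSpace Finset Filter

namespace Summit.QuantumFields.BalabanUV.T4Continuum.NE7SliceFrameMatchingLimit

open Literature.MathematicalPhysics.QuantumFieldTheory.Balaban1983to89
open B7Prop1Explicit B7Prop2Explicit MatrixLog
open T4AveragingDeficitWall (IsUnitaryCfg SmallField vary)
open T4AveragingDeficitWallBoundary (IsPeriodicCfg)
open AveragingDeficitMultiLevelPrep (LevelSmall tower)
open NE3EnergyShapes (IsUnitarySite IsPeriodicSite)
open NE3TangentCovariantTower (framePotW)
open NE3QbarIterCovLiftPrep (cruxC)
open NE3CurvedFrameKill (framePotW_add)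
open NE3LinearisedAverageSup (norm_framePotW_le_sup curvSum)
open NE3RightInverseSupLetters (supC)
open NE7SliceIterationState (repLog cornerLog tangentPart frameMismatch sliceDefect sliceDefect_nonneg siteSup_le siteSup_nonneg)
open NE7SliceIterationStateFacts (norm_frame_le_frameMismatch frameMismatch_le_sliceDefect)
open NE7SliceTangentPartLimit (norm_tangentPart_sub_le norm_cornerLog_sub_le)
open NE7SliceLimitWorkingRegion (workingRegion_of_limit)

noncomputable section

variable {d : ℕ} {n : Type*} [Fintype n] [DecidableEq n] [Nonempty n]

/-! ## §1 The accumulated frame of a difference -/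

section Sub

variable {L : ℕ} (hL : 2 ≤ L) (j : ℕ) {W : Site d → Fin d → (Matrix n n ℂ)ˣ} {x : ℝ} (hWu : IsUnitaryCfg W) (hx : 0 ≤ x) (hs : LevelSmall d L j x)
  (hWx : SmallField W x)

include hL hWu hx hs hWx in
/-- **THE ACCUMULATED FRAME OF A DIFFERENCE** in the multi-level small-field class: `framePotW L (j+1) W (A − B) z = framePotW L (j+1) W A z − framePotW L (j+1) W B z`
(`NE3CurvedFrameKill.framePotW_add`). [folklore] -/
theorem framePotW_sub (A B : Site d → Fin d → Matrix n n ℂ) (z : Site d) :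
    framePotW L (j + 1) W (fun y ν => A y ν - B y ν) z = framePotW L (j + 1) W A z - framePotW L (j + 1) W B z := by
  have hL1 : 1 ≤ L := le_trans one_le_two hL
  have h := framePotW_add hL1 j hWu hx hs hWx (fun y ν => A y ν - B y ν) B z
  simp only [sub_add_cancel] at h
  exact eq_sub_of_add_eq h.symm

include hL hWu hx hs hWx in
/-- **`‖framePotW A z − framePotW B z‖ ≤ 6d·L^{j+1}·s`** whenever `‖A b − B b‖ ≤ s` at every bond (`0 ≤ s`; `curvSum d L (j+1) x ≤ 2L∕3`) — `framePotW_sub` +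
`NE3LinearisedAverageSup.norm_framePotW_le_sup`. [folklore] -/
theorem norm_framePotW_sub_le (hA : curvSum d L (j + 1) x ≤ 2 / 3 * L) {A B : Site d → Fin d → Matrix n n ℂ} {s : ℝ} (hs0 : 0 ≤ s)
    (hAB : ∀ (y : Site d) (μ : Fin d), ‖A y μ - B y μ‖ ≤ s) (z : Site d) :
    ‖framePotW L (j + 1) W A z - framePotW L (j + 1) W B z‖ ≤ 6 * (d : ℝ) * (L : ℝ) ^ (j + 1) * s := by
  rw [← framePotW_sub hL j hWu hx hs hWx A B z]
  exact norm_framePotW_le_sup hL j hWu hx hs hWx (Y := fun y ν => A y ν - B y ν) hs0 hAB hA z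

end Sub

/-! ## §2 Two states of the working region -/

section TwoStates

variable {L : ℕ} (hL : 2 ≤ L) (k : ℕ) {W : Site d → Fin d → (Matrix n n ℂ)ˣ} {x : ℝ} (hWu : IsUnitaryCfg W) (hx : 0 ≤ x) (hs : LevelSmall d L k x)
  (hWx : SmallField W x) (N : ℕ) [NeZero N] (hθ : cruxC d L * (((L : ℝ) ^ (k + 1)) ^ 2 * x) < 1) (U' : Site d → Fin d → (Matrix n n ℂ)ˣ)
  (hWP : IsPeriodicCfg W ((tower L N (k + 1) : ℕ) : ℤ)) (hU'u : IsUnitaryCfg U') (hU'P : IsPeriodicCfg U' ((tower L N (k + 1) : ℕ) : ℤ))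
  (hε : ((L : ℝ) ^ (k + 1)) ^ 2 * x ≤ 1) (hA : curvSum d L (k + 1) x ≤ 2 / 3 * L)
  {u v : Site d → (Matrix n n ℂ)ˣ} (hu : IsUnitarySite u) (huP : IsPeriodicSite u ((tower L N (k + 1) : ℕ) : ℤ))
  (hgu : gaugeAct u U' = vary W (repLog W U' u) 1) (hXu : ∀ y κ, ‖repLog W U' u y κ‖ ≤ 1 / 8)
  (hcu : ∀ z, ((u (((L : ℤ) ^ (k + 1)) • z) : (Matrix n n ℂ)ˣ) : Matrix n n ℂ) = exp (cornerLog L k u z)) (hhu : ∀ z, ‖cornerLog L k u z‖ ≤ 1 / 8)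
  (hv : IsUnitarySite v) (hvP : IsPeriodicSite v ((tower L N (k + 1) : ℕ) : ℤ))
  (hgv : gaugeAct v U' = vary W (repLog W U' v) 1) (hXv : ∀ y κ, ‖repLog W U' v y κ‖ ≤ 1 / 8)
  (hcv : ∀ z, ((v (((L : ℤ) ^ (k + 1)) • z) : (Matrix n n ℂ)ˣ) : Matrix n n ℂ) = exp (cornerLog L k v z)) (hhv : ∀ z, ‖cornerLog L k v z‖ ≤ 1 / 8)
  {ρ : ℝ} (hρ : ∀ y, ‖((u y : (Matrix n n ℂ)ˣ) : Matrix n n ℂ) - (v y : (Matrix n n ℂ)ˣ)‖ ≤ ρ)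

include hL hθ in
/-- the sup-Lipschitz constant of the tangent part, `lipT = (8∕3)(1 + supC∕(M(1 − cruxC·M²x))·((3+12d)M + 1))`, is nonnegative. [folklore] -/
theorem lipT_nonneg :
    0 ≤ 8 / 3 * (1 + supC d L / ((L : ℝ) ^ (k + 1) * (1 - cruxC d L * (((L : ℝ) ^ (k + 1)) ^ 2 * x))) * ((3 + 12 * (d : ℝ)) * (L : ℝ) ^ (k + 1) + 1)) := by
  have hsupC : 0 ≤ supC d L := by
    unfold supC NE3RightInverseSupLetters.corrC NE3RightInverseSupLetters.frameC; have := NE3QbarIterCovLiftPrep.liftC_nonneg d; positivity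
  have hM : 0 < (L : ℝ) ^ (k + 1) := pow_pos (by exact_mod_cast (by omega : 0 < L)) _
  have hden : 0 < (L : ℝ) ^ (k + 1) * (1 - cruxC d L * (((L : ℝ) ^ (k + 1)) ^ 2 * x)) := mul_pos hM (by linarith)
  have h1 : 0 ≤ supC d L / ((L : ℝ) ^ (k + 1) * (1 - cruxC d L * (((L : ℝ) ^ (k + 1)) ^ 2 * x))) := div_nonneg hsupC hden.le
  positivity

include hL hWu hx hs hWx hWP hU'u hU'P hu huP hgu hXu hcu hhu hv hvP hgv hXv hcv hhv hρ hA hε in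
/-- **THE ACCUMULATED FRAME OF THE TANGENT PART IS SUP-LIPSCHITZ IN THE GAUGE**: `‖framePotW T(u) z − framePotW T(v) z‖ ≤ 6dM·lipT·sup‖u − v‖` on the working region
(`norm_framePotW_sub_le` + `NE7SliceTangentPartLimit.norm_tangentPart_sub_le`). [folklore] -/
theorem norm_framePotW_tangentPart_sub_le (z : Site d) :
    ‖framePotW L (k + 1) W (tangentPart hL k hWu hx hs hWx N hθ U' u) z - framePotW L (k + 1) W (tangentPart hL k hWu hx hs hWx N hθ U' v) z‖
      ≤ 6 * (d : ℝ) * (L : ℝ) ^ (k + 1)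
        * ((8 / 3 * (1 + supC d L / ((L : ℝ) ^ (k + 1) * (1 - cruxC d L * (((L : ℝ) ^ (k + 1)) ^ 2 * x))) * ((3 + 12 * (d : ℝ)) * (L : ℝ) ^ (k + 1) + 1))) * ρ) := by
  have hρ0 : 0 ≤ ρ := (norm_nonneg _).trans (hρ 0)
  have hs0 : 0 ≤ (8 / 3 * (1 + supC d L / ((L : ℝ) ^ (k + 1) * (1 - cruxC d L * (((L : ℝ) ^ (k + 1)) ^ 2 * x))) * ((3 + 12 * (d : ℝ)) * (L : ℝ) ^ (k + 1) + 1))) * ρ :=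
    mul_nonneg (lipT_nonneg hL k hθ) hρ0
  exact norm_framePotW_sub_le hL k hWu hx hs hWx hA hs0
    (fun y μ => norm_tangentPart_sub_le hL k hWu hx hs hWx N hθ U' hWP hU'u hU'P hε hA hu huP hgu hXu hcu hhu hv hvP hgv hXv hcv hhv hρ y μ) z

include hL hWu hx hs hWx hWP hU'u hU'P hu huP hgu hXu hcu hhu hv hvP hgv hXv hcv hhv hρ hA hε in
/-- **THE FRAME MISMATCH OF A STATE IS CONTROLLED BY THE DEFECT OF A NEIGHBOUR**: for `u`, `v` on the working region with `sup‖u − v‖ ≤ ρ`,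
`‖framePotW T(v) z − h(v) z‖ ≤ M·Df(u) + (6dM·lipT + 4∕3)·ρ` (three terms: `F(T(v)) − F(T(u))`, `F(T(u)) − h(u)` by `norm_frame_le_frameMismatch` + `frameMismatch_le_sliceDefect`,
`h(u) − h(v)` by `norm_cornerLog_sub_le`). [folklore] -/
theorem norm_frame_le_of_near (z : Site d) :
    ‖framePotW L (k + 1) W (tangentPart hL k hWu hx hs hWx N hθ U' v) z - cornerLog L k v z‖
      ≤ (L : ℝ) ^ (k + 1) * sliceDefect hL k hWu hx hs hWx N hθ U' u
        + (6 * (d : ℝ) * (L : ℝ) ^ (k + 1)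
            * (8 / 3 * (1 + supC d L / ((L : ℝ) ^ (k + 1) * (1 - cruxC d L * (((L : ℝ) ^ (k + 1)) ^ 2 * x))) * ((3 + 12 * (d : ℝ)) * (L : ℝ) ^ (k + 1) + 1)))
          + 4 / 3) * ρ := by
  -- the three terms
  have h1 := norm_framePotW_tangentPart_sub_le hL k hWu hx hs hWx N hθ U' hWP hU'u hU'P hε hA hu huP hgu hXu hcu hhu hv hvP hgv hXv hcv hhv hρ z
  have h2 : ‖framePotW L (k + 1) W (tangentPart hL k hWu hx hs hWx N hθ U' u) z - cornerLog L k u z‖ ≤ (L : ℝ) ^ (k + 1) * sliceDefect hL k hWu hx hs hWx N hθ U' u :=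
    (norm_frame_le_frameMismatch hL k hWu hx hs hWx N hθ U' hWP hU'u hU'P hu huP hgu hXu hcu hhu z).trans (frameMismatch_le_sliceDefect hL k hWu hx hs hWx N hθ U' u)
  have h3 : ‖cornerLog L k u z - cornerLog L k v z‖ ≤ 4 / 3 * ρ :=
    (norm_cornerLog_sub_le k hcu hhu hcv hhv z).trans (mul_le_mul_of_nonneg_left (hρ _) (by norm_num))
  have e : framePotW L (k + 1) W (tangentPart hL k hWu hx hs hWx N hθ U' v) z - cornerLog L k v z
      = -(framePotW L (k + 1) W (tangentPart hL k hWu hx hs hWx N hθ U' u) z - framePotW L (k + 1) W (tangentPart hL k hWu hx hs hWx N hθ U' v) z)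
        + (framePotW L (k + 1) W (tangentPart hL k hWu hx hs hWx N hθ U' u) z - cornerLog L k u z) + (cornerLog L k u z - cornerLog L k v z) := by abel
  rw [e]
  calc ‖-(framePotW L (k + 1) W (tangentPart hL k hWu hx hs hWx N hθ U' u) z - framePotW L (k + 1) W (tangentPart hL k hWu hx hs hWx N hθ U' v) z)
        + (framePotW L (k + 1) W (tangentPart hL k hWu hx hs hWx N hθ U' u) z - cornerLog L k u z) + (cornerLog L k u z - cornerLog L k v z)‖
      ≤ ‖-(framePotW L (k + 1) W (tangentPart hL k hWu hx hs hWx N hθ U' u) z - framePotW L (k + 1) W (tangentPart hL k hWu hx hs hWx N hθ U' v) z)‖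
        + ‖framePotW L (k + 1) W (tangentPart hL k hWu hx hs hWx N hθ U' u) z - cornerLog L k u z‖ + ‖cornerLog L k u z - cornerLog L k v z‖ := norm_add₃_le
    _ ≤ 6 * (d : ℝ) * (L : ℝ) ^ (k + 1)
          * ((8 / 3 * (1 + supC d L / ((L : ℝ) ^ (k + 1) * (1 - cruxC d L * (((L : ℝ) ^ (k + 1)) ^ 2 * x))) * ((3 + 12 * (d : ℝ)) * (L : ℝ) ^ (k + 1) + 1))) * ρ)
        + (L : ℝ) ^ (k + 1) * sliceDefect hL k hWu hx hs hWx N hθ U' u + 4 / 3 * ρ := by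
          rw [norm_neg]; exact add_le_add (add_le_add h1 h2) h3
    _ = _ := by ring

end TwoStates

/-! ## §3 The limit — rate shape of `NE7SliceTangentPartLimit.tangentPart_limit_mem` -/

section Limit

variable {L : ℕ} (hL : 2 ≤ L) (k : ℕ) {W : Site d → Fin d → (Matrix n n ℂ)ˣ} {x : ℝ} (hWu : IsUnitaryCfg W) (hx : 0 ≤ x) (hs : LevelSmall d L k x)
  (hWx : SmallField W x) (N : ℕ) [NeZero N] (hθ : cruxC d L * (((L : ℝ) ^ (k + 1)) ^ 2 * x) < 1) (U' : Site d → Fin d → (Matrix n n ℂ)ˣ)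
  (hWP : IsPeriodicCfg W ((tower L N (k + 1) : ℕ) : ℤ)) (hU'u : IsUnitaryCfg U') (hU'P : IsPeriodicCfg U' ((tower L N (k + 1) : ℕ) : ℤ))
  (hε : ((L : ℝ) ^ (k + 1)) ^ 2 * x ≤ 1) (hA : curvSum d L (k + 1) x ≤ 2 / 3 * L)

include hWP hU'u hU'P hε hA in
/-- **FRAME MATCHING AT THE LIMIT (rate shape).**  Multi-level small-field class at `W` (`L ≥ 2`, `M²x ≤ 1`, `curvSum ≤ 2L∕3`, `cruxC·M²x < 1`), `W`, `U′` unitary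
`(tower)`-periodic; `u : ℕ → gauges` and `u⋆` on the working region (unitary, `(tower)`-periodic, chart `U′^{u} = W·e^{X(u)}`, `‖X(u)‖ ≤ 1∕8`, corners `u(M•z) = e^{h(u) z}`,
`‖h(u)‖ ≤ 1∕8`), a UNIFORM rate `‖u j y − u⋆ y‖ ≤ r j → 0` and `Df(u j) → 0`.  THEN `framePotW L (k+1) W T(u⋆) z = h(u⋆) z` for every `z` (`norm_frame_le_of_near` with `u := u j`,
`v := u⋆`, `ρ := r j`, and `j → ∞`). [folklore] -/
theorem framePotW_limit_eq_cornerLog (u : ℕ → Site d → (Matrix n n ℂ)ˣ) (ulim : Site d → (Matrix n n ℂ)ˣ)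
    (hu : ∀ j, IsUnitarySite (u j)) (huP : ∀ j, IsPeriodicSite (u j) ((tower L N (k + 1) : ℕ) : ℤ))
    (hgu : ∀ j, gaugeAct (u j) U' = vary W (repLog W U' (u j)) 1) (hXu : ∀ j y κ, ‖repLog W U' (u j) y κ‖ ≤ 1 / 8)
    (hcu : ∀ j z, (((u j) (((L : ℤ) ^ (k + 1)) • z) : (Matrix n n ℂ)ˣ) : Matrix n n ℂ) = exp (cornerLog L k (u j) z)) (hhu : ∀ j z, ‖cornerLog L k (u j) z‖ ≤ 1 / 8)
    (hl : IsUnitarySite ulim) (hlP : IsPeriodicSite ulim ((tower L N (k + 1) : ℕ) : ℤ))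
    (hgl : gaugeAct ulim U' = vary W (repLog W U' ulim) 1) (hXl : ∀ y κ, ‖repLog W U' ulim y κ‖ ≤ 1 / 8)
    (hcl : ∀ z, ((ulim (((L : ℤ) ^ (k + 1)) • z) : (Matrix n n ℂ)ˣ) : Matrix n n ℂ) = exp (cornerLog L k ulim z)) (hhl : ∀ z, ‖cornerLog L k ulim z‖ ≤ 1 / 8)
    (r : ℕ → ℝ) (hrate : ∀ j y, ‖(((u j) y : (Matrix n n ℂ)ˣ) : Matrix n n ℂ) - (ulim y : (Matrix n n ℂ)ˣ)‖ ≤ r j) (hr : Tendsto r atTop (𝓝 0))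
    (hDf : Tendsto (fun j => sliceDefect hL k hWu hx hs hWx N hθ U' (u j)) atTop (𝓝 0)) :
    ∀ z, framePotW L (k + 1) W (tangentPart hL k hWu hx hs hWx N hθ U' ulim) z = cornerLog L k ulim z := by
  intro z
  set C : ℝ := 6 * (d : ℝ) * (L : ℝ) ^ (k + 1)
      * (8 / 3 * (1 + supC d L / ((L : ℝ) ^ (k + 1) * (1 - cruxC d L * (((L : ℝ) ^ (k + 1)) ^ 2 * x))) * ((3 + 12 * (d : ℝ)) * (L : ℝ) ^ (k + 1) + 1)))
    + 4 / 3 with hC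
  -- the finite-`j` letter, constant left-hand side
  have hbound : ∀ j, ‖framePotW L (k + 1) W (tangentPart hL k hWu hx hs hWx N hθ U' ulim) z - cornerLog L k ulim z‖
      ≤ (L : ℝ) ^ (k + 1) * sliceDefect hL k hWu hx hs hWx N hθ U' (u j) + C * r j := fun j => by
    rw [hC]
    exact norm_frame_le_of_near hL k hWu hx hs hWx N hθ U' hWP hU'u hU'P hε hA (hu j) (huP j) (hgu j) (hXu j) (hcu j) (hhu j)
      hl hlP hgl hXl hcl hhl (hrate j) z
  have hlim0 : Tendsto (fun j => (L : ℝ) ^ (k + 1) * sliceDefect hL k hWu hx hs hWx N hθ U' (u j) + C * r j) atTop (𝓝 0) := by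
    have := (hDf.const_mul ((L : ℝ) ^ (k + 1))).add (hr.const_mul C)
    simpa using this
  have h0 : ‖framePotW L (k + 1) W (tangentPart hL k hWu hx hs hWx N hθ U' ulim) z - cornerLog L k ulim z‖ ≤ 0 :=
    ge_of_tendsto' hlim0 hbound
  exact sub_eq_zero.mp (norm_le_zero_iff.mp h0)

include hWP hU'u hU'P hε hA in
/-- **`m(u⋆) = 0`** (rate shape): the frame mismatch of the limit vanishes. [folklore] -/
theorem frameMismatch_limit_eq_zero_of_rate (u : ℕ → Site d → (Matrix n n ℂ)ˣ) (ulim : Site d → (Matrix n n ℂ)ˣ)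
    (hu : ∀ j, IsUnitarySite (u j)) (huP : ∀ j, IsPeriodicSite (u j) ((tower L N (k + 1) : ℕ) : ℤ))
    (hgu : ∀ j, gaugeAct (u j) U' = vary W (repLog W U' (u j)) 1) (hXu : ∀ j y κ, ‖repLog W U' (u j) y κ‖ ≤ 1 / 8)
    (hcu : ∀ j z, (((u j) (((L : ℤ) ^ (k + 1)) • z) : (Matrix n n ℂ)ˣ) : Matrix n n ℂ) = exp (cornerLog L k (u j) z)) (hhu : ∀ j z, ‖cornerLog L k (u j) z‖ ≤ 1 / 8)
    (hl : IsUnitarySite ulim) (hlP : IsPeriodicSite ulim ((tower L N (k + 1) : ℕ) : ℤ))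
    (hgl : gaugeAct ulim U' = vary W (repLog W U' ulim) 1) (hXl : ∀ y κ, ‖repLog W U' ulim y κ‖ ≤ 1 / 8)
    (hcl : ∀ z, ((ulim (((L : ℤ) ^ (k + 1)) • z) : (Matrix n n ℂ)ˣ) : Matrix n n ℂ) = exp (cornerLog L k ulim z)) (hhl : ∀ z, ‖cornerLog L k ulim z‖ ≤ 1 / 8)
    (r : ℕ → ℝ) (hrate : ∀ j y, ‖(((u j) y : (Matrix n n ℂ)ˣ) : Matrix n n ℂ) - (ulim y : (Matrix n n ℂ)ˣ)‖ ≤ r j) (hr : Tendsto r atTop (𝓝 0))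
    (hDf : Tendsto (fun j => sliceDefect hL k hWu hx hs hWx N hθ U' (u j)) atTop (𝓝 0)) :
    frameMismatch hL k hWu hx hs hWx N hθ U' ulim = 0 := by
  have hF := framePotW_limit_eq_cornerLog hL k hWu hx hs hWx N hθ U' hWP hU'u hU'P hε hA u ulim hu huP hgu hXu hcu hhu hl hlP hgl hXl hcl hhl r hrate hr hDf
  have hN1 : 1 ≤ N := Nat.one_le_iff_ne_zero.mpr (NeZero.ne N)
  refine le_antisymm ?_ (siteSup_nonneg fun z => norm_nonneg _)
  exact siteSup_le hN1 fun z => by rw [hF z, sub_self, norm_zero]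

end Limit

/-! ## §4 The limit — one-call shape of `NE7SliceLimitWorkingRegion.tangentPart_limit_mem_of_geometric` (the asked signature) -/

section Geometric

variable {L : ℕ} (hL : 2 ≤ L) (k : ℕ) {W : Site d → Fin d → (Matrix n n ℂ)ˣ} {x : ℝ} (hWu : IsUnitaryCfg W) (hx : 0 ≤ x) (hs : LevelSmall d L k x)
  (hWx : SmallField W x) (N : ℕ) [NeZero N] (hθ : cruxC d L * (((L : ℝ) ^ (k + 1)) ^ 2 * x) < 1) (U' : Site d → Fin d → (Matrix n n ℂ)ˣ)
  (hWP : IsPeriodicCfg W ((tower L N (k + 1) : ℕ) : ℤ)) (hU'u : IsUnitaryCfg U') (hU'P : IsPeriodicCfg U' ((tower L N (k + 1) : ℕ) : ℤ))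
  (hε : ((L : ℝ) ^ (k + 1)) ^ 2 * x ≤ 1) (hA : curvSum d L (k + 1) x ≤ 2 / 3 * L)

include hWP hU'u hU'P hε hA in
/-- **FRAME MATCHING AT THE LIMIT — `frameMismatch_limit_eq_zero` ([NE7P1-G102-ASK-1]).**  From exactly the data `NE7SliceIterationOrbit(Weighted).slice_orbit(_w)` delivers and
`NE7SliceTheorem.slice_theorem` holds — the working-region facts for every `u j`, a unitary `(tower)`-periodic SITEWISE limit `u⋆`, a geometric rate `‖u j y − u⋆ y‖ ≤ C·ϑ^j` and
`Df(u j) ≤ ϑ^j·δ₀` (`0 ≤ ϑ < 1`) — **`framePotW L (k+1) W (tangentPart … u⋆) z = cornerLog L k u⋆ z` for every coarse site `z`**: the accumulated frame of the limit's tangent part IS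
the limit's corner log, `h⋆ = F(T⋆)`.  The chart∕corner facts at `u⋆` come from gen 150's `workingRegion_of_limit`; then `framePotW_limit_eq_cornerLog`.  Same binders, same order as
`tangentPart_limit_mem_of_geometric`. [folklore] -/
theorem frameMismatch_limit_eq_zero (u : ℕ → Site d → (Matrix n n ℂ)ˣ) (ulim : Site d → (Matrix n n ℂ)ˣ)
    (hu : ∀ j, IsUnitarySite (u j)) (huP : ∀ j, IsPeriodicSite (u j) ((tower L N (k + 1) : ℕ) : ℤ))
    (hgu : ∀ j, gaugeAct (u j) U' = vary W (repLog W U' (u j)) 1) (hXu : ∀ j y κ, ‖repLog W U' (u j) y κ‖ ≤ 1 / 8)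
    (hcu : ∀ j z, (((u j) (((L : ℤ) ^ (k + 1)) • z) : (Matrix n n ℂ)ˣ) : Matrix n n ℂ) = exp (cornerLog L k (u j) z)) (hhu : ∀ j z, ‖cornerLog L k (u j) z‖ ≤ 1 / 8)
    (hl : IsUnitarySite ulim) (hlP : IsPeriodicSite ulim ((tower L N (k + 1) : ℕ) : ℤ))
    (hconv : ∀ y, Tendsto (fun j => (((u j) y : (Matrix n n ℂ)ˣ) : Matrix n n ℂ)) atTop (𝓝 ((ulim y : (Matrix n n ℂ)ˣ) : Matrix n n ℂ)))
    {C ϑ δ₀ : ℝ} (hϑ0 : 0 ≤ ϑ) (hϑ1 : ϑ < 1)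
    (hrate : ∀ j y, ‖(((u j) y : (Matrix n n ℂ)ˣ) : Matrix n n ℂ) - (ulim y : (Matrix n n ℂ)ˣ)‖ ≤ C * ϑ ^ j)
    (hDf : ∀ j, sliceDefect hL k hWu hx hs hWx N hθ U' (u j) ≤ ϑ ^ j * δ₀) :
    ∀ z, framePotW L (k + 1) W (tangentPart hL k hWu hx hs hWx N hθ U' ulim) z = cornerLog L k ulim z := by
  obtain ⟨hgl, hXl, hcl, hhl⟩ := workingRegion_of_limit k hWu hU'u hu hl hconv hgu hXu hcu hhu
  have hpow : Tendsto (fun j => ϑ ^ j) atTop (𝓝 0) := tendsto_pow_atTop_nhds_zero_of_lt_one hϑ0 hϑ1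
  have hr : Tendsto (fun j => C * ϑ ^ j) atTop (𝓝 0) := by simpa using hpow.const_mul C
  have hDf0 : Tendsto (fun j => sliceDefect hL k hWu hx hs hWx N hθ U' (u j)) atTop (𝓝 0) := by
    have hup : Tendsto (fun j => ϑ ^ j * δ₀) atTop (𝓝 0) := by simpa using hpow.mul_const δ₀
    exact squeeze_zero (fun j => sliceDefect_nonneg hL k hWu hx hs hWx N hθ U' (u j)) hDf hup
  exact framePotW_limit_eq_cornerLog hL k hWu hx hs hWx N hθ U' hWP hU'u hU'P hε hA u ulim hu huP hgu hXu hcu hhu hl hlP hgl hXl hcl hhl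
    (fun j => C * ϑ ^ j) hrate hr hDf0

include hWP hU'u hU'P hε hA in
/-- **`frameMismatch … u⋆ = 0`** in the same one-call shape: the box sup `m(u⋆) = sup_z ‖framePotW T(u⋆) z − h(u⋆) z‖` vanishes. [folklore] -/
theorem frameMismatch_limit_val_eq_zero (u : ℕ → Site d → (Matrix n n ℂ)ˣ) (ulim : Site d → (Matrix n n ℂ)ˣ)
    (hu : ∀ j, IsUnitarySite (u j)) (huP : ∀ j, IsPeriodicSite (u j) ((tower L N (k + 1) : ℕ) : ℤ))
    (hgu : ∀ j, gaugeAct (u j) U' = vary W (repLog W U' (u j)) 1) (hXu : ∀ j y κ, ‖repLog W U' (u j) y κ‖ ≤ 1 / 8)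
    (hcu : ∀ j z, (((u j) (((L : ℤ) ^ (k + 1)) • z) : (Matrix n n ℂ)ˣ) : Matrix n n ℂ) = exp (cornerLog L k (u j) z)) (hhu : ∀ j z, ‖cornerLog L k (u j) z‖ ≤ 1 / 8)
    (hl : IsUnitarySite ulim) (hlP : IsPeriodicSite ulim ((tower L N (k + 1) : ℕ) : ℤ))
    (hconv : ∀ y, Tendsto (fun j => (((u j) y : (Matrix n n ℂ)ˣ) : Matrix n n ℂ)) atTop (𝓝 ((ulim y : (Matrix n n ℂ)ˣ) : Matrix n n ℂ)))
    {C ϑ δ₀ : ℝ} (hϑ0 : 0 ≤ ϑ) (hϑ1 : ϑ < 1)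
    (hrate : ∀ j y, ‖(((u j) y : (Matrix n n ℂ)ˣ) : Matrix n n ℂ) - (ulim y : (Matrix n n ℂ)ˣ)‖ ≤ C * ϑ ^ j)
    (hDf : ∀ j, sliceDefect hL k hWu hx hs hWx N hθ U' (u j) ≤ ϑ ^ j * δ₀) :
    frameMismatch hL k hWu hx hs hWx N hθ U' ulim = 0 := by
  have hF := frameMismatch_limit_eq_zero hL k hWu hx hs hWx N hθ U' hWP hU'u hU'P hε hA u ulim hu huP hgu hXu hcu hhu hl hlP hconv hϑ0 hϑ1 hrate hDf
  have hN1 : 1 ≤ N := Nat.one_le_iff_ne_zero.mpr (NeZero.ne N)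
  refine le_antisymm ?_ (siteSup_nonneg fun z => norm_nonneg _)
  exact siteSup_le hN1 fun z => by rw [hF z, sub_self, norm_zero]

end Geometric

/-! ## §5 (v2 APPEND) THE LIMIT IS AN EXACT FIXED POINT OF THE SLICE STEP: trivial split, zero defect, `ζ(u⋆) = 0`, `sliceStep u⋆ = u⋆` -/

section FixedPoint

open AveragingDeficitTwoLevelPrep (prop1Radius)
open SpreadLift (loopRad)
open BlockAveragePushDirGauge (gaugeDir)
open NE3CovariantBlockMean (bmeanIterW)
open NE7MeanZeroGaugeSliceW (energyBlockLandauW)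
open NE7SliceIterationState (gaugeFun slicePart sliceStep bondSup bondSup_le bondSup_nonneg)
open NE7SliceIterationStateFacts (split_holds norm_gaugeFun_le)
open NE7SliceSplitUnique (slice_split_of_mem)
open NE7SliceLimitWorkingRegion (tangentPart_limit_mem_of_geometric)

variable {L : ℕ} (hL : 2 ≤ L) (k : ℕ) {W : Site d → Fin d → (Matrix n n ℂ)ˣ} {x : ℝ} (hWu : IsUnitaryCfg W) (hx : 0 ≤ x) (hs : LevelSmall d L k x)
  (hWx : SmallField W x) (N : ℕ) [NeZero N] (hθ : cruxC d L * (((L : ℝ) ^ (k + 1)) ^ 2 * x) < 1) (U' : Site d → Fin d → (Matrix n n ℂ)ˣ)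
  (hWP : IsPeriodicCfg W ((tower L N (k + 1) : ℕ) : ℤ)) (hU'u : IsUnitaryCfg U') (hU'P : IsPeriodicCfg U' ((tower L N (k + 1) : ℕ) : ℤ))
  (hε : ((L : ℝ) ^ (k + 1)) ^ 2 * x ≤ 1) (hA : curvSum d L (k + 1) x ≤ 2 / 3 * L)
  (u : ℕ → Site d → (Matrix n n ℂ)ˣ) (ulim : Site d → (Matrix n n ℂ)ˣ)
  (hu : ∀ j, IsUnitarySite (u j)) (huP : ∀ j, IsPeriodicSite (u j) ((tower L N (k + 1) : ℕ) : ℤ))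
  (hgu : ∀ j, gaugeAct (u j) U' = vary W (repLog W U' (u j)) 1) (hXu : ∀ j y κ, ‖repLog W U' (u j) y κ‖ ≤ 1 / 8)
  (hcu : ∀ j z, (((u j) (((L : ℤ) ^ (k + 1)) • z) : (Matrix n n ℂ)ˣ) : Matrix n n ℂ) = exp (cornerLog L k (u j) z)) (hhu : ∀ j z, ‖cornerLog L k (u j) z‖ ≤ 1 / 8)
  (hl : IsUnitarySite ulim) (hlP : IsPeriodicSite ulim ((tower L N (k + 1) : ℕ) : ℤ))
  (hconv : ∀ y, Tendsto (fun j => (((u j) y : (Matrix n n ℂ)ˣ) : Matrix n n ℂ)) atTop (𝓝 ((ulim y : (Matrix n n ℂ)ˣ) : Matrix n n ℂ)))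
  {C ϑ δ₀ : ℝ} (hϑ0 : 0 ≤ ϑ) (hϑ1 : ϑ < 1)
  (hrate : ∀ j y, ‖(((u j) y : (Matrix n n ℂ)ˣ) : Matrix n n ℂ) - (ulim y : (Matrix n n ℂ)ˣ)‖ ≤ C * ϑ ^ j)
  (hDf : ∀ j, sliceDefect hL k hWu hx hs hWx N hθ U' (u j) ≤ ϑ ^ j * δ₀)

include hWP hU'u hU'P hε hA hu huP hgu hXu hcu hhu hl hlP hconv hϑ0 hϑ1 hrate hDf in
/-- **THE CHOSEN SPLIT OF THE LIMIT IS TRIVIAL** (one-call shape): `Ỹ(u⋆) = T(u⋆)` and `gaugeDir W ζ(u⋆) = 0` at every bond — `T(u⋆) ∈ 𝒯_E(W)` (`tangentPart_limit_mem_of_geometric`), the nested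
mean of `ζ(u⋆)` is `−(F(T(u⋆)) − h(u⋆)) = 0` (`frameMismatch_limit_eq_zero`), so the chosen normalised split (`split_holds` at `u⋆`, facts from `workingRegion_of_limit`) is a split of a slice
element with mean-zero gauge function: `NE7SliceSplitUnique.slice_split_of_mem`. [folklore] -/
theorem split_limit_trivial :
    (∀ y μ, slicePart hL k hWu hx hs hWx N hθ U' ulim y μ = tangentPart hL k hWu hx hs hWx N hθ U' ulim y μ) ∧
      ∀ y μ, gaugeDir W (gaugeFun hL k hWu hx hs hWx N hθ U' ulim) y μ = 0 := by
  obtain ⟨hgl, hXl, hcl, hhl⟩ := workingRegion_of_limit k hWu hU'u hu hl hconv hgu hXu hcu hhu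
  have hT := tangentPart_limit_mem_of_geometric hL k hWu hx hs hWx N hθ U' hWP hU'u hU'P hε hA u ulim hu huP hgu hXu hcu hhu hl hlP hconv hϑ0 hϑ1 hrate hDf
  have hF := frameMismatch_limit_eq_zero hL k hWu hx hs hWx N hθ U' hWP hU'u hU'P hε hA u ulim hu huP hgu hXu hcu hhu hl hlP hconv hϑ0 hϑ1 hrate hDf
  obtain ⟨hζs, hζP, hY, hsplit, hmean⟩ := split_holds hL k hWu hx hs hWx N hθ U' hWP hU'u hU'P hl hlP hgl hXl hcl hhl
  have hmean0 : bmeanIterW L (k + 1) W (gaugeFun hL k hWu hx hs hWx N hθ U' ulim) = 0 := by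
    funext z; rw [Pi.zero_apply, hmean z, hF z, sub_self, neg_zero]
  haveI : NeZero L := ⟨by omega⟩
  exact slice_split_of_mem k hWP hT hY hζs hζP hsplit hmean0

include hWP hU'u hU'P hε hA hu huP hgu hXu hcu hhu hl hlP hconv hϑ0 hϑ1 hrate hDf in
/-- **`Ỹ(u⋆) = T(u⋆)`**: the slice part of the limit is its tangent part. [folklore] -/
theorem slicePart_limit_eq_tangentPart : slicePart hL k hWu hx hs hWx N hθ U' ulim = tangentPart hL k hWu hx hs hWx N hθ U' ulim :=
  funext fun y => funext fun μ => (split_limit_trivial hL k hWu hx hs hWx N hθ U' hWP hU'u hU'P hε hA u ulim hu huP hgu hXu hcu hhu hl hlP hconv hϑ0 hϑ1 hrate hDf).1 y μ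

include hWP hU'u hU'P hε hA hu huP hgu hXu hcu hhu hl hlP hconv hϑ0 hϑ1 hrate hDf in
/-- **ZERO DEFECT AT THE LIMIT — `Df(u⋆) = 0`**: `δ(u⋆) = sup‖gaugeDir W ζ(u⋆)‖ = 0` (`split_limit_trivial`) and `m(u⋆) = 0` (`frameMismatch_limit_val_eq_zero`). [folklore] -/
theorem sliceDefect_limit_eq_zero : sliceDefect hL k hWu hx hs hWx N hθ U' ulim = 0 := by
  have hG := (split_limit_trivial hL k hWu hx hs hWx N hθ U' hWP hU'u hU'P hε hA u ulim hu huP hgu hXu hcu hhu hl hlP hconv hϑ0 hϑ1 hrate hDf).2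
  have hm := frameMismatch_limit_val_eq_zero hL k hWu hx hs hWx N hθ U' hWP hU'u hU'P hε hA u ulim hu huP hgu hXu hcu hhu hl hlP hconv hϑ0 hϑ1 hrate hDf
  haveI : NeZero L := ⟨by omega⟩
  have hP1 : 1 ≤ tower L N (k + 1) := Nat.one_le_iff_ne_zero.mpr (NeZero.ne _)
  have hδ : bondSup (tower L N (k + 1)) (fun y μ => ‖gaugeDir W (gaugeFun hL k hWu hx hs hWx N hθ U' ulim) y μ‖) = 0 :=
    le_antisymm (bondSup_le hP1 le_rfl fun y μ => by rw [hG y μ, norm_zero]) (bondSup_nonneg fun y μ => norm_nonneg _)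
  unfold sliceDefect
  rw [hδ, hm, zero_div, add_zero]

include hWP hU'u hU'P hε hA hu huP hgu hXu hcu hhu hl hlP hconv hϑ0 hϑ1 hrate hDf in
/-- **`ζ(u⋆) = 0`** for Poincaré parameter `θ_P ≤ 1∕2` (`‖ζ(u⋆) y‖ ≤ 6dM·Df(u⋆) = 0`, `NE7SliceIterationStateFacts.norm_gaugeFun_le`). [folklore] -/
theorem gaugeFun_limit_eq_zero (hd : 0 < d)
    (hθP : 4 * (d : ℝ) ^ 2 * ((L : ℝ) ^ (k + 1) - 1) ^ 2 * x + 16 * d * loopRad d L ((prop1Radius d L)^[k] x)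
        + 4 * d * ((d : ℝ) - 1) * ((L : ℝ) ^ (k + 1) - 1) ^ 2 * x ≤ 1 / 2) (y : Site d) :
    gaugeFun hL k hWu hx hs hWx N hθ U' ulim y = 0 := by
  obtain ⟨hgl, hXl, hcl, hhl⟩ := workingRegion_of_limit k hWu hU'u hu hl hconv hgu hXu hcu hhu
  have h := norm_gaugeFun_le hL k hWu hx hs hWx N hθ U' hWP hU'u hU'P hl hlP hgl hXl hcl hhl hd hθP y
  rw [sliceDefect_limit_eq_zero hL k hWu hx hs hWx N hθ U' hWP hU'u hU'P hε hA u ulim hu huP hgu hXu hcu hhu hl hlP hconv hϑ0 hϑ1 hrate hDf, mul_zero] at h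
  exact norm_le_zero_iff.mp h

include hWP hU'u hU'P hε hA hu huP hgu hXu hcu hhu hl hlP hconv hϑ0 hϑ1 hrate hDf in
/-- **THE LIMIT IS A FIXED POINT OF THE (S1) STEP — `sliceStep u⋆ = u⋆`** (Poincaré parameter `θ_P ≤ 1∕2`): `e^{−ζ(u⋆)}·u⋆ = u⋆` since `ζ(u⋆) = 0`. [folklore] -/
theorem sliceStep_limit_eq_self (hd : 0 < d)
    (hθP : 4 * (d : ℝ) ^ 2 * ((L : ℝ) ^ (k + 1) - 1) ^ 2 * x + 16 * d * loopRad d L ((prop1Radius d L)^[k] x)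
        + 4 * d * ((d : ℝ) - 1) * ((L : ℝ) ^ (k + 1) - 1) ^ 2 * x ≤ 1 / 2) :
    sliceStep hL k hWu hx hs hWx N hθ U' ulim = ulim := by
  funext y
  have hζ := gaugeFun_limit_eq_zero hL k hWu hx hs hWx N hθ U' hWP hU'u hU'P hε hA u ulim hu huP hgu hXu hcu hhu hl hlP hconv hϑ0 hϑ1 hrate hDf hd hθP y
  show expUnit (-gaugeFun hL k hWu hx hs hWx N hθ U' ulim y) * ulim y = ulim y
  rw [hζ, neg_zero, T4AveragingDeficitWall.expUnit_zero, one_mul]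

end FixedPoint

end

end Summit.QuantumFields.BalabanUV.T4Continuum.NE7SliceFrameMatchingLimit
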